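import Literature.NumberTheory.LFunctions.FordProgram1
import HarnessLib

/-!
# Ford's "Program 1": kernel run 10B (`575 ≤ k ≤ 584`)

Topic `Literature/NumberTheory/LFunctions`. Everything here is PROVED (kernel evaluations, standard
axioms): `FordP1.checkT k = true` for `575 ≤ k ≤ 584`, i.e. the certified re-run of PROGRAM 1 of
K. Ford, Proc. LMS 85 (2002) (the second part of Theorem 3) for these `k` — see `FordProgram1.lean`
for the checker, its soundness `FordP1.row_of_checkK`, and the meaning of the constants
(`ρ = FordP1.rhoOf k / 10⁵`, `θ = FordP1.thetaOf k / 10⁴`, `ω = FordP1.omOf k / 10⁴`). One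
`decide +kernel` per `k` (so that the kernel's evaluation state is bounded by a single run;
`maxHeartbeats 0` lifts the deterministic time-out for each), then the range statement
`FordP1.run10B`. The three parts 10A–10C are re-assembled in the original `List.all` form as
`FordP1.run10` (`FordProgram1Run10.lean`), which the assembly `FordTheorem3SmallK.lean` uses.

## References

* K. Ford, Proc. London Math. Soc. (3) 85 (2002), 565–633; arXiv:1910.08209: Theorem 3, (1.7),
  Lemmas 3.4–3.5, Appendix "PROGRAM 1". [Ford2002]
-/

namespace Literature.NumberTheory.LFunctions
namespace FordP1

set_option maxHeartbeats 0 in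
/-- `checkT 575`. [cite: Ford2002, Theorem 3 (second part) and PROGRAM 1] -/
theorem checkT_575 : checkT 575 = true := by
  decide +kernel

set_option maxHeartbeats 0 in
/-- `checkT 576`. [cite: Ford2002, Theorem 3 (second part) and PROGRAM 1] -/
theorem checkT_576 : checkT 576 = true := by
  decide +kernel

set_option maxHeartbeats 0 in
/-- `checkT 577`. [cite: Ford2002, Theorem 3 (second part) and PROGRAM 1] -/
theorem checkT_577 : checkT 577 = true := by
  decide +kernel

set_option maxHeartbeats 0 in
/-- `checkT 578`. [cite: Ford2002, Theorem 3 (second part) and PROGRAM 1] -/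
theorem checkT_578 : checkT 578 = true := by
  decide +kernel

set_option maxHeartbeats 0 in
/-- `checkT 579`. [cite: Ford2002, Theorem 3 (second part) and PROGRAM 1] -/
theorem checkT_579 : checkT 579 = true := by
  decide +kernel

set_option maxHeartbeats 0 in
/-- `checkT 580`. [cite: Ford2002, Theorem 3 (second part) and PROGRAM 1] -/
theorem checkT_580 : checkT 580 = true := by
  decide +kernel

set_option maxHeartbeats 0 in
/-- `checkT 581`. [cite: Ford2002, Theorem 3 (second part) and PROGRAM 1] -/
theorem checkT_581 : checkT 581 = true := by
  decide +kernel

set_option maxHeartbeats 0 in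
/-- `checkT 582`. [cite: Ford2002, Theorem 3 (second part) and PROGRAM 1] -/
theorem checkT_582 : checkT 582 = true := by
  decide +kernel

set_option maxHeartbeats 0 in
/-- `checkT 583`. [cite: Ford2002, Theorem 3 (second part) and PROGRAM 1] -/
theorem checkT_583 : checkT 583 = true := by
  decide +kernel

set_option maxHeartbeats 0 in
/-- `checkT 584`. [cite: Ford2002, Theorem 3 (second part) and PROGRAM 1] -/
theorem checkT_584 : checkT 584 = true := by
  decide +kernel

/-- **Kernel run 10B**: `checkT k` for `575 ≤ k ≤ 584`. [cite: Ford2002, Theorem 3 (second part)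
and PROGRAM 1] -/
theorem run10B (k : ℕ) (h1 : 575 ≤ k) (h2 : k ≤ 584) : checkT k = true := by
  interval_cases k
  · exact checkT_575
  · exact checkT_576
  · exact checkT_577
  · exact checkT_578
  · exact checkT_579
  · exact checkT_580
  · exact checkT_581
  · exact checkT_582
  · exact checkT_583
  · exact checkT_584

end FordP1
end Literature.NumberTheory.LFunctions
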